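import Summits.Ventures.AbcSig.Recipes.BS04

/-!
# Venture AbcSig — a COMPUTABLE generator for the exponent-specific (Kraus) trace tables, kernel-checked against tables of record

HONEST FRAMING. Infrastructure file of the computation cell `pub-abcsig`; no Diophantine statement, no claim on ABC or any
summit, and NO new hypothesis. The cell's module M4 / single-exponent rows use EXPONENT-SPECIFIC allowed-trace tables
(`krausAllowed_C7_*`, `krausTab_*`; DATA transcribed from engine files, correctness = the named hypothesis
`NewformModel.RefinedTraces`, `Rows/TemplateKraus.lean`). This file gives the SAME tables as the value of ONE computable
function, `krausTable`, which is a line-by-line transcription of the referee's independent generator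
`HOME/referee/refallowed.py` (ref-g2; itself the published recipe):

* Frey curves of `A xⁿ + B yⁿ = C z²` over `𝔽_q` ([BS04, p. 27]; `u = bⁿ`, `c` the `z`-coordinate, `q` odd, `q ∤ ABC`):
  `E₁` (cases (i), (ii)): `Y² = X³ + 2cC·X² + BC·u·X`; `E₂` (cases (iii), (iv)): `Y² = X³ + cC·X² + (BC·u/4)·X`;
  `E₃` (case (v), after completing the square): `Y² = X³ + (cC/4)·X² + (BC·u/64)·X` — `FreyModel`, `FreyCase.model`,
  `FreyModel.coeffs`.
* Kraus's refinement [Kra97; BS04, Prop. 4.3]: at an auxiliary prime `q` (typically `q ≡ 1 (mod n)`), `u = bⁿ` and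
  `aⁿ = (C c² − B u)/A` range over the NONZERO `n`-TH POWER RESIDUES only (`nthPowerResidues`); `q ∣ ab` gives multiplicative
  reduction and the traces `±(q + 1)` [BS04, Lemma 4.2].
* `krausTable μ A B C n q` = the sorted, duplicate-free list `{±(q+1)} ∪ {a_q(E_μ(u, c)) : u ∈ (𝔽_q^×)ⁿ, c ∈ 𝔽_q,
  (C c² − B u)/A ∈ (𝔽_q^×)ⁿ}`, the trace computed as `−Σ_x χ(x³ + a₂x² + a₄x)` with `χ` by Euler's criterion (`legendreNaive`,
  `traceNaive`).

KERNEL CROSS-CHECKS live in the companion file `Recipes/KrausTableCheck.lean` (`decide +kernel`, no `native_decide`): there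
`krausTable` REPRODUCES tables of record transcribed from the engines' files — engine-2's `krausAllowed_C7_v_n11` /
`krausAllowed_C7_i_n11` / `krausAllowed_C7_v_n13` (integer traces), p1's module-M4 residue tables `krausTab_C23e_n11` and the
C2a class tables of `census/rows/C2a/M4/M4p1_a0_*` / `M4p1_a3_*` (residues mod `n`) — so three implementations (engine-2 / p1,
the referee's, this file) agree on those entries, one of them inside the kernel. Two sanity values are checked below. What this
file does NOT do: prove that `krausTable` contains the trace of every Frey curve of an actual solution (that is [BS04, p. 27 +
(3.1)] + Kraus — the CITED half of `RefinedTraces`), nor replace any row's hypothesis. Intended use (Monday item, HOME/plean/g6/README-g6.md design note): the completeness clause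
`CONJ_LR32_L2″` quantifies over "newforms not excluded by the Kraus tables", which needs the tables as a FUNCTION of
`(family, n, q)` — this file — rather than the vacuous `∀ A, RefinedTraces fam A → …`.
Downstream (p-lean g7, same evening): `Recipes/KrausTableCheck.lean` (kernel reproductions of the tables of record),
`Conjectures/KrausTableSemantics.lean` (`traceNaive` = trace of Frobenius), `Conjectures/KrausTableRefines.lean` (`krausTable ⊆ bs04Allowed`),
the class-by-class M4 discharges `Levels/N…M4C….lean`, and p1 g10's `Recipes/FreyTracePackage.lean` (`freyTrace_mem_krausTable`: soundness for
actual solutions).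

References: A. Kraus, *Majorations effectives pour l'équation de Fermat généralisée*, Canad. J. Math. 49 (1997) 1139–1161;
[BS04] M. A. Bennett, C. M. Skinner, Canad. J. Math. 56 (2004) 23–54, p. 27, Lemma 4.2, Prop. 4.3; cell records
HOME/referee/refallowed.py, HOME/referee/KRAUS-SWEEP-REFEREE.md, engine/engine-2/results/C7/, census/rows/*/M4/.
-/

namespace Summit.Ventures.AbcSig

/-! ## Arithmetic over `𝔽_q` by naive computation (all inputs are natural-number residues; `q` an odd prime) -/

/-- Inverse of `a` modulo the prime `q` (`a^{q−2} mod q`; meaningful for `q ∤ a`). -/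
def invModP (q a : ℕ) : ℕ := a ^ (q - 2) % q

/-- The Legendre symbol `(v / q) ∈ {0, 1, −1}` by Euler's criterion (`q` an odd prime). -/
def legendreNaive (q v : ℕ) : ℤ :=
  if v % q = 0 then 0 else if v ^ ((q - 1) / 2) % q = 1 then 1 else -1

/-- Trace of Frobenius of `Y² = X³ + a₂X² + a₄X` over `𝔽_q`: `a_q = −Σ_{x mod q} χ(x³ + a₂x² + a₄x)` (nonsingular cubic assumed). -/
def traceNaive (q a₂ a₄ : ℕ) : ℤ :=
  -(((List.range q).map fun x => legendreNaive q (x ^ 3 + a₂ * x ^ 2 + a₄ * x)).sum)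

/-- The nonzero `n`-th power residues modulo `q`, as a duplicate-free list. -/
def nthPowerResidues (q n : ℕ) : List ℕ :=
  (((List.range q).filter fun x => x ≠ 0).map fun x => x ^ n % q).dedup

/-! ## The three Frey models of [BS04, p. 27] over `𝔽_q` -/

/-- The three Weierstrass models of [BS04, p. 27]: `E₁` (cases (i), (ii)), `E₂` (cases (iii), (iv)), `E₃` (case (v)). -/
inductive FreyModel where
  | E1 | E2 | E3
  deriving DecidableEq, Repr

/-- Which model each case of [BS04, pp. 26–27] uses. -/
def FreyCase.model : FreyCase → FreyModel
  | .i | .iiB | .iiC => .E1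
  | .iii₁ | .iii₂ | .iv₃ | .iv₄₅ => .E2
  | .v₆ | .v₇ => .E3

/-- Coefficients `(a₂, a₄)` over `𝔽_q` of the model with `bⁿ ≡ u`, `z ≡ c`: `E₁: (2cC, BCu)`, `E₂: (cC, BCu/4)`,
`E₃: (cC/4, BCu/64)` (the last after completing the square in `Y² + XY = X³ + ((cC − 1)/4)X² + (BCu/64)X`). -/
def FreyModel.coeffs : FreyModel → (q B C u c : ℕ) → ℕ × ℕ
  | .E1, q, B, C, u, c => (2 * c * C % q, B * C * u % q)
  | .E2, q, B, C, u, c => (c * C % q, B * C * u * invModP q 4 % q)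
  | .E3, q, B, C, u, c => (c * C * invModP q 4 % q, B * C * u * invModP q 64 % q)

/-! ## The table -/

/-- Insert an integer into a sorted duplicate-free list. -/
def insertSorted (t : ℤ) : List ℤ → List ℤ
  | [] => [t]
  | s :: rest => if t < s then t :: s :: rest else if t = s then s :: rest else s :: insertSorted t rest

/-- **The exponent-specific (Kraus) allowed-trace table** of the family `A xⁿ + B yⁿ = C z²` in the Frey model `μ` at the odd
prime `q ∤ ABC`, exponent `n`: sorted list of `±(q + 1)` and the traces `a_q(E_μ(u, c))` over all `u ∈ (𝔽_q^×)ⁿ`, `c ∈ 𝔽_q`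
with `aⁿ = (C c² − B u)/A ∈ (𝔽_q^×)ⁿ` (transcription of HOME/referee/refallowed.py). For `gcd(n, q − 1) = 1` every unit is an
`n`-th power and the table is the generic image; the refinement bites at `q ≡ 1 (mod n)`. -/
def krausTable (μ : FreyModel) (A B C n q : ℕ) : List ℤ :=
  let U := nthPowerResidues q n
  let Ainv := invModP q A
  let traces : List ℤ := U.flatMap fun u => (List.range q).filterMap fun c =>
    let an := (C * c * c % q + q - B * u % q) % q * Ainv % q
    if an ≠ 0 ∧ an ∈ U then
      let p := μ.coeffs q B C u c
      some (traceNaive q p.1 p.2)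
    else none
  traces.foldl (fun acc t => insertSorted t acc) [-((q : ℤ) + 1), (q : ℤ) + 1]

/-- The table as a function of the prime, `bs04Allowed` away from a given list of auxiliary primes — the shape in which the
cell's rows consume tables (`krausAllowed_C7_*`, `krausTab_*`). -/
def krausTableAt (μ : FreyModel) (A B C n : ℕ) (aux : List ℕ) (q : ℕ) : List ℤ :=
  if q ∈ aux then krausTable μ A B C n q else bs04Allowed q

/-- The table reduced modulo the exponent `n` (sorted residues in `[0, n)`) — the shape of the cell's module-M4 tables
(`krausTab_*` in `Levels/N…M4Kn….lean`, `S_q_mod_n` in `census/rows/*/M4/M4p1_*.json`). -/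
def krausTableMod (μ : FreyModel) (A B C n q : ℕ) : List ℤ :=
  (krausTable μ A B C n q).foldl (fun acc t => insertSorted (t % (n : ℤ)) acc) []

/-- Union of several tables (sorted, duplicate-free). -/
def mergeTables (Ls : List (List ℤ)) : List ℤ :=
  Ls.foldl (fun acc L => L.foldl (fun a t => insertSorted t a) acc) []

/-! ## Sanity values (the full cross-check against tables of record is `Recipes/KrausTableCheck.lean`) -/

/-- `x¹¹ + y¹¹ = 7z²`, case (v), at `q = 23 ≡ 1 (mod 11)`: only `0` and `±24` (engine-2's `allowed_C7_casev_n11_full.json`,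
transcribed as `krausAllowed_C7_v_n11 23 = [-24, 0, 24]` in `Levels/N98K11.lean`). -/
example : krausTable .E3 1 1 7 11 23 = [-24, 0, 24] := by decide +kernel

/-- Away from `q ≡ 1 (mod n)` the refinement is void: at `q = 13`, `n = 11` the table is the generic [BS04, Lemma 4.2] list. -/
example : krausTable .E3 1 1 7 11 13 = bs04Allowed 13 := by decide +kernel

end Summit.Ventures.AbcSig

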